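import Summits.ABC.ABC.Theses.DefiniteXi
import Summits.ABC.ABC.Theorems.DefiniteXiFreyModularity
import Summits.ABC.ABC.Theorems.DefiniteXiDefiniteRTControlPrimeSmulTransportDeg
import Summits.ABC.ABC.Theorems.DefiniteXiDefiniteRTControlPrimeValTransport
import Summits.ABC.ABC.Theorems.DefiniteXiDefiniteRTControlPrimeFreyScale
import Summits.ABC.ABC.Theorems.DefiniteXiDefiniteRTControlPrimeFreyLocal
import Literature.NumberTheory.EllipticCurves.TakahashiDegreeFormulaCoprimeProofs
import Literature.NumberTheory.EllipticCurves.CuspFormLFunctionLevelConductorProofs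
import Literature.NumberTheory.EllipticCurves.ModularCurveManinSemistableBridgeProofs
import Literature.NumberTheory.EllipticCurves.BrandtModuleJLSelfPairing
import Literature.NumberTheory.EllipticCurves.PastenSpectralDegree
import Literature.NumberTheory.EllipticCurves.PastenHeightBounds
import Literature.NumberTheory.EllipticCurves.PastenHeightBoundsLemma68Proofs
import Literature.NumberTheory.EllipticCurves.ModularDegreeMinimal
import Literature.NumberTheory.EllipticCurves.IsogenyVariableChangeProofs
import Literature.NumberTheory.EllipticCurves.IsogenyCompProofs
import Literature.NumberTheory.EllipticCurves.IsogenyDualProofs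
import Literature.NumberTheory.EllipticCurves.SzpiroLocalDataProofs
import Literature.NumberTheory.Automorphic.EichlerSubidealCount
import Literature.NumberTheory.Automorphic.HeckeTraceFormulaGL2Level
import Literature.NumberTheory.DiophantineGeometry.GeneralizedFermatTwoPowerCoefficientFreyProofs
import Literature.NumberTheory.DiophantineGeometry.GeneralizedFermatTwoPowerCoefficientSerreProofs
import HarnessLib

/-!
# Stub ideas k2, generation 2 (FAMILY 2 — RESHAPE) for `stub_takahashi`
# (`takahashi2001_thm_2_3_of_coprime`), crux `DefiniteRTControlPrime`, route `DefiniteXi`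

Scratch sketch of the ideator (elaboration sanity only; `sorry` allowed in helper statements;
not a proposal, not a skeleton edit).  Companion of `STUB-IDEAS-stub_takahashi-2.md` (gen 2).

* **T1 — pinned normal form.**  `pairingGcd w g = i₀(g)` := the non-negative generator of the
  ideal `{Σ_i w_i g_i y_i : Σ_i y_i = 0} = gcd_{a,b} (w_a g_a − w_b g_b) ℤ`; the stub is implied by
  (rank one ∧) the existential-free statement `takahashiPinned_of_coprime`
  (`i₀ ∣ c_r ∧ δ · i₀² = ξ · c_r`), `i₀ ∣ ξ` being AUTOMATIC (degree zero of the eigenvector).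
* **T2 — local-optimal re-cut.**  `takahashi2001_thm_2_3_optimal` (binders: `r` prime,
  `gcd(M, r) = 1`, `f_r(W) = 1`, `P` lattice-optimal; NO global conductor, NO minimality clause);
  `stub_of_optimal` (the stub as typed from it + Carayol, 8 lines, PROVED) and the kernel-checked
  alternative composition `DefiniteRTControlPrime_of_optimal` (same constant `4·163²`, the
  conductor-restricted pivot and Carayol deleted; one new bookkeeping stub
  `factorization_conductorNorm_eq_one_of_isIsogenous_freyCurve`, PROVED here).
* **T3 — Frey-level regime.**  `IsFreyLevel`, `factorization_conductorNorm_freyCurve_le_one`.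
-/

set_option linter.dupNamespace false

noncomputable section

open scoped BigOperators
open CongruenceSubgroup IsDedekindDomain

namespace Summit.ABC.ABC.Cruxes.DefiniteRTControlPrime.StubIdeas2G2

open Summit.ABC.ABC.Theses.DefiniteXi
open Literature.NumberTheory.EllipticCurves Literature.NumberTheory.EllipticCurves.ModularForms
open Literature.NumberTheory.Automorphic Literature.NumberTheory.Automorphic.Brandt
open WeierstrassCurve

/-! ## T1. The pinned normal form (`i₀ =` the pairing gcd) -/

section Pinned

variable {ι : Type*} [Fintype ι]

/-- **`i₀(w, g)`**: the non-negative generator of the ideal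
`I(g) = {Σ_i w_i g_i y_i : y ∈ ℤ^ι, Σ_i y_i = 0} = (w_a g_a − w_b g_b : a, b ∈ ι) ⊆ ℤ`
(Takahashi 2001, Lemma 2.2: "`i_r` generates the ideal `I_r`", for `X = ℤ[Cls O]⁰` and Gross's
pairing `⟨e_i, e_j⟩ = w_i δ_ij`). Brandt-computable. -/
def pairingGcd (w : ι → ℕ) (g : ι → ℤ) : ℕ :=
  ((Finset.univ : Finset (ι × ι)).gcd
    fun p => (w p.1 : ℤ) * g p.1 - (w p.2 : ℤ) * g p.2).natAbs

/-- **L0a** (S): `i₀` divides every value of the pairing on the degree-zero part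
(`Σ_i c_i y_i = Σ_i (c_i − c_b) y_i` when `Σ y_i = 0`). -/
theorem pairingGcd_dvd_sum (w : ι → ℕ) (g y : ι → ℤ) (hy : ∑ i, y i = 0) :
    (pairingGcd w g : ℤ) ∣ ∑ i, (w i : ℤ) * g i * y i := by
  classical
  unfold pairingGcd
  rw [Int.natAbs_dvd]
  rcases isEmpty_or_nonempty ι with hι | ⟨⟨b⟩⟩
  · simp
  · have key : ∑ i, (w i : ℤ) * g i * y i = ∑ i, ((w i : ℤ) * g i - (w b : ℤ) * g b) * y i := by
      have h : ∑ i, ((w i : ℤ) * g i - (w b : ℤ) * g b) * y i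
          = ∑ i, (w i : ℤ) * g i * y i - (w b : ℤ) * g b * ∑ i, y i := by
        rw [Finset.mul_sum, ← Finset.sum_sub_distrib]
        exact Finset.sum_congr rfl fun i _ => by ring
      rw [h, hy, mul_zero, sub_zero]
    rw [key]
    exact Finset.dvd_sum fun i _ =>
      dvd_mul_of_dvd_left (Finset.gcd_dvd (Finset.mem_univ (i, b))) _

/-- **L0b** (S): Bezout — `i₀` is attained on the degree-zero part (so `I(g) = i₀ ℤ`). Pattern:
the private `exists_sum_mul_eq_gcd` of `Literature/Combinatorics/Additive/LevSmeliansky.lean`. -/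
theorem exists_sum_eq_pairingGcd (w : ι → ℕ) (g : ι → ℤ) :
    ∃ y : ι → ℤ, ∑ i, y i = 0 ∧ ∑ i, (w i : ℤ) * g i * y i = pairingGcd w g := by
  sorry

/-- **L1** (XS, PROVED): the `ℕ`-arithmetic from the pinned identities to the stub's conclusion
(`i := i₀`, `j := c / i₀`). -/
theorem stubShape_of_pinned {δ ξ c i : ℕ} (hc : 0 < c) (hic : i ∣ c) (hiξ : i ∣ ξ)
    (h : δ * i ^ 2 = ξ * c) :
    ∃ i' j : ℕ, 0 < i' ∧ i' * j = c ∧ i' ∣ ξ ∧ δ * i' = ξ * j := by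
  obtain ⟨j, rfl⟩ := hic
  have hi : 0 < i := Nat.pos_of_ne_zero fun h0 => by simp [h0] at hc
  refine ⟨i, j, hi, rfl, hiξ, Nat.eq_of_mul_eq_mul_right hi ?_⟩
  calc δ * i * i = δ * i ^ 2 := by ring
    _ = ξ * (i * j) := h
    _ = ξ * j * i := by ring

/-- **L1′** (XS, PROVED): conversely the stub's conclusion gives the square identity for its `i`
(tree: `takahashi2001_thm_2_3_of_coprime.xi_mul_eq_modularDegree_mul_sq`). -/
theorem pinnedShape_of_stubShape {δ ξ c i j : ℕ} (hij : i * j = c) (h : δ * i = ξ * j) :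
    δ * i ^ 2 = ξ * c := by
  calc δ * i ^ 2 = δ * i * i := by ring
    _ = ξ * j * i := by rw [h]
    _ = ξ * c := by rw [← hij]; ring

/-- **L2** (S): `i₀ ∣ ξ_S` is AUTOMATIC — the primitive eigenvector `g` has degree zero
(`XiSetup.sum_eq_zero_of_eigenLattice_lFunction_eq_span`, any level) and `ξ_S = Σ w_i g_i²`
(`xi_lFunction_eq_sum`), so `ξ_S = ⟨g, g⟩ ∈ I(g) = i₀ ℤ` (L0a with `y := g`). -/
theorem pairingGcd_dvd_xi {M r : ℕ} (S : Brandt.XiSetup M r) [Fintype (Brandt.ClassSet S.O)]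
    (W : WeierstrassCurve ℚ) [W.IsElliptic] {g : Brandt.ClassSet S.O → ℤ} (hg : g ≠ 0)
    (hL : Brandt.eigenLattice (M * r) (Brandt.matrix S.O) (fun n => W.LFunction n) = ℤ ∙ g) :
    pairingGcd (Brandt.weight S.O) g ∣ S.xi (fun n => W.LFunction n) := by
  have h0 : ∑ i, g i = 0 := S.sum_eq_zero_of_eigenLattice_lFunction_eq_span W hL
  have h1 := pairingGcd_dvd_sum (Brandt.weight S.O) g g h0
  have h2 : S.xi (fun n => W.LFunction n) = ∑ i, Brandt.weight S.O i * (g i).natAbs ^ 2 :=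
    xi_lFunction_eq_sum W S hg hL
  have h3 : ((S.xi (fun n => W.LFunction n) : ℕ) : ℤ) =
      ∑ i, (Brandt.weight S.O i : ℤ) * g i * g i := by
    rw [h2]
    simp only [Nat.cast_sum, Nat.cast_mul, Nat.cast_pow, Int.natCast_natAbs, sq_abs]
    exact Finset.sum_congr rfl fun i _ => by ring
  rw [← h3] at h1
  exact Int.natCast_dvd_natCast.mp h1

/-- **T♭ = the pinned normal form of the stub** (named-fact candidate; Takahashi 2001 Lemma 2.2 +
Thm. 2.3 + the identification of p. 84 with `X = ℤ[Cls O]⁰`, Kohel 2001 Thm. 4.3 / Ribet 1990 §3;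
exactly the "finer prediction" verified in 578 cases by the CoprimeProofs audit, job j018422):
for the datum `P` of the stub and EVERY generator `g` of the `a(W)`-eigen-line of the Brandt
matrices of a setup of type `(M, r)`, with `i₀ := pairingGcd w g` and `c_r := ord_r Δ_min(W)`:
`i₀ ∣ c_r` and `δ · i₀² = ξ_S · c_r`.  No `∃`, no lattice, no maps. -/
def takahashiPinned_of_coprime : Prop :=
  ∀ (W : WeierstrassCurve ℚ) [W.IsElliptic] (M r : ℕ) [NeZero (M * r)],
    r.Prime → M.Coprime r → W.conductorNorm ℤ = M * r →
    ∀ P : ModularParametrizationData W (M * r),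
      (∀ (W' : WeierstrassCurve ℚ) [W'.IsElliptic], W'.conductorNorm ℤ = M * r →
          ∀ P' : ModularParametrizationData W' (M * r),
          P'.f = P.f → P.modularDegree ≤ P'.modularDegree) →
      ∀ (S : Brandt.XiSetup M r) [Fintype (Brandt.ClassSet S.O)] (g : Brandt.ClassSet S.O → ℤ),
        g ≠ 0 →
        Brandt.eigenLattice (M * r) (Brandt.matrix S.O) (fun n => W.LFunction n) = ℤ ∙ g →
        pairingGcd (Brandt.weight S.O) g ∣ (W.minimalDiscriminantNorm ℤ).factorization r ∧
        P.modularDegree * pairingGcd (Brandt.weight S.O) g ^ 2 =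
          S.xi (fun n => W.LFunction n) * (W.minimalDiscriminantNorm ℤ).factorization r

/-- The quaternionic half, verbatim k3's `brandtEigenLattice_rank_one_of_coprime` / k1's
`rankOneCoprime` (Takahashi p. 78; Pizer 1980 Thm. 2.28; in tree at square-free level:
`takahashi2001_brandtEigenLattice_rank_one_holds`). -/
def brandtEigenLattice_rank_one_of_coprime : Prop :=
  ∀ (W : WeierstrassCurve ℚ) [W.IsElliptic] (M r : ℕ) [NeZero (M * r)],
    r.Prime → M.Coprime r → W.conductorNorm ℤ = M * r →
    ∀ (_P : ModularParametrizationData W (M * r)) (S : Brandt.XiSetup M r)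
      [Fintype (Brandt.ClassSet S.O)],
      Module.finrank ℤ
        (Brandt.eigenLattice (M * r) (Brandt.matrix S.O) (fun n => W.LFunction n)) = 1

/-- `c_r = ord_r Δ_min(W) > 0` for `r ∣ N_W` (verbatim the opening of
`Takahashi2001.exists_ij_of_brandtData`; PROVED). -/
theorem factorization_minimalDiscriminantNorm_pos {W : WeierstrassCurve ℚ} [W.IsElliptic]
    {M r : ℕ} (hr : r.Prime) (hN : W.conductorNorm ℤ = M * r) :
    0 < (W.minimalDiscriminantNorm ℤ).factorization r := by
  have hfin := WeierstrassCurve.finite_setOf_ordMinimalDiscriminant_ne_zero_holds (A := ℤ) W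
  have hdvd : W.conductorNorm ℤ ∣ W.minimalDiscriminantNorm ℤ :=
    W.conductorNorm_dvd_minimalDiscriminantNorm hfin
  have hpos : 0 < W.minimalDiscriminantNorm ℤ := W.minimalDiscriminantNorm_pos_holds
  have hrd : r ∣ W.minimalDiscriminantNorm ℤ := dvd_trans ⟨M, by rw [hN, mul_comm]⟩ hdvd
  exact hr.factorization_pos_of_dvd hpos.ne' hrd

/-- **L3 — ASSEMBLY of T1** (S, PROVED modulo L2): rank one ∧ T♭ ⇒ the stub. -/
theorem stub_of_pinned (h1 : brandtEigenLattice_rank_one_of_coprime)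
    (h2 : takahashiPinned_of_coprime) : takahashi2001_thm_2_3_of_coprime := by
  intro W _ M r _ hr hcop hN P hmin S
  classical
  haveI : Fintype (Brandt.ClassSet S.O) := Fintype.ofFinite _
  obtain ⟨g, hg, hL⟩ :=
    Takahashi2001.exists_eq_span_of_finrank_eq_one (h1 W M r hr hcop hN P S)
  obtain ⟨hic, hsq⟩ := h2 W M r hr hcop hN P hmin S g hg hL
  exact stubShape_of_pinned (factorization_minimalDiscriminantNorm_pos hr hN) hic
    (pairingGcd_dvd_xi S W hg hL) hsq

/-! ### T♭ versus the pinned dictionary (k1 gen-2 `dictCoprimePinned`): the same statement -/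

/-- The degree-zero sublattice `ℤ[ι]⁰` (k1: `degreeZeroLattice`). -/
def degreeZeroInt (ι : Type*) [Fintype ι] : Submodule ℤ (ι → ℤ) :=
  LinearMap.ker (∑ i : ι, LinearMap.proj i)

/-- **L3′** (M): T♭-data ⇒ the pinned Brandt package (`pb a := a (c/i₀) g`, `pf y := ⟨g, y⟩ / i₀`,
`j := c / i₀`; adjunction, `pf ∘ pb = δ`, `pf` onto by L0b, `pb 1 = j g`). Pointwise, pure algebra. -/
theorem brandtPackage_of_pinned (w : ι → ℕ) (g : ι → ℤ) (hg0 : ∑ i, g i = 0) {δ c : ℕ}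
    (hc : 0 < c) (hic : pairingGcd w g ∣ c)
    (hsq : (δ : ℤ) * (pairingGcd w g : ℤ) ^ 2 = (∑ i, (w i : ℤ) * g i * g i) * c) :
    ∃ (pb : ℤ →ₗ[ℤ] degreeZeroInt ι) (pf : degreeZeroInt ι →ₗ[ℤ] ℤ) (j : ℤ),
      (∀ (a : ℤ) (y : degreeZeroInt ι),
          ∑ i, (w i : ℤ) * (pb a : ι → ℤ) i * (y : ι → ℤ) i = (c : ℤ) * a * pf y) ∧
      (∀ a : ℤ, pf (pb a) = (δ : ℤ) * a) ∧ Function.Surjective pf ∧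
      (pb 1 : ι → ℤ) = j • g := by
  sorry

/-- **L3″** (M): conversely a Brandt package on ANY `X` containing the eigen-line generator forces
the pinned identities for `i₀` computed on `X`; for `X = ℤ[ι]⁰` this is T♭
(tree algebra: `Takahashi2001.exists_generator_range_pairing`, `exists_nat_index_formula`). -/
theorem pinned_of_brandtPackage (w : ι → ℕ) (g : ι → ℤ) (hg : g ≠ 0) (hg0 : ∑ i, g i = 0)
    {δ c : ℕ} (hc : 0 < c) (pb : ℤ →ₗ[ℤ] degreeZeroInt ι) (pf : degreeZeroInt ι →ₗ[ℤ] ℤ) (j : ℤ)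
    (hadj : ∀ (a : ℤ) (y : degreeZeroInt ι),
      ∑ i, (w i : ℤ) * (pb a : ι → ℤ) i * (y : ι → ℤ) i = (c : ℤ) * a * pf y)
    (hδ : ∀ a : ℤ, pf (pb a) = (δ : ℤ) * a) (hsurj : Function.Surjective pf)
    (hpb : (pb 1 : ι → ℤ) = j • g) :
    pairingGcd w g ∣ c ∧
      (δ : ℤ) * (pairingGcd w g : ℤ) ^ 2 = (∑ i, (w i : ℤ) * g i * g i) * c := by
  sorry

end Pinned

/-! ## T2. The local-optimal re-cut and the Carayol seam (no `hES` any more) -/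

/-- **L4 (PROVED, 4 lines)**: a datum of minimal degree among the data of the conductor-`N`
curves with its newform is LATTICE-OPTIMAL, granted Carayol's level theorem (`hCar`, named fact
`IsNewformOf.level_eq_conductorNorm`) — the tree's
`latticeEq_of_forall_conductor_modularDegree_le` with its `hES` input now DISCHARGED by
`ModularParametrizationData.exists_optimalDatum'`. -/
theorem latticeOptimal_of_conductorMinimal {N : ℕ} [NeZero N]
    (hCar : IsNewformOf.level_eq_conductorNorm (N := N))
    {W : WeierstrassCurve ℚ} [W.IsElliptic] (P : ModularParametrizationData W N)
    (hmin : ∀ (W' : WeierstrassCurve ℚ) [W'.IsElliptic], W'.conductorNorm ℤ = N →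
      ∀ P' : ModularParametrizationData W' N, P'.f = P.f → P.modularDegree ≤ P'.modularDegree) :
    ∀ z ∈ P.L.lattice, ∃ w ∈ periodLattice P.f, z = P.c * w := by
  obtain ⟨W₀, hW₀, D₀, hf₀, h₀⟩ := P.exists_optimalDatum'
  haveI := hW₀
  have hN₀ : W₀.conductorNorm ℤ = N := (hCar D₀.isNewformOf).symm
  exact P.latticeEq_of_modularDegree_le D₀ hf₀ h₀ (hmin W₀ hN₀ D₀ hf₀)

/-- **T_opt — the local-optimal form of Takahashi Thm. 2.3 at `r ∥ N`** (named-fact candidate;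
Takahashi 2001 Thm. 2.3 for THE optimal quotient; Pasten 2024 Prop. 6.13: only multiplicative
reduction at `r` is used).  Binders: `r` prime, `gcd(M, r) = 1`, `f_r(W) = 1` (⇔ multiplicative
at `r`: `conductorExponent_eq_one_iff_holds`, `factorization_conductorNorm_holds`), `P` a datum
at level `M r` with `Λ_W = c Λ_f` (lattice-optimal: `W ≅ E_f`, `deg φ_P = δ_1`).  NO global
conductor hypothesis, NO minimality clause — hence consumable at the skeleton's `(W₀, D₀, h₀)`. -/
def takahashi2001_thm_2_3_optimal : Prop :=
  ∀ (W : WeierstrassCurve ℚ) [W.IsElliptic] (M r : ℕ) [NeZero (M * r)],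
    r.Prime → M.Coprime r → (W.conductorNorm ℤ).factorization r = 1 →
    ∀ P : ModularParametrizationData W (M * r),
      (∀ z ∈ P.L.lattice, ∃ w ∈ periodLattice P.f, z = P.c * w) →
      ∀ S : Brandt.XiSetup M r,
        ∃ i j : ℕ, 0 < i ∧ i * j = (W.minimalDiscriminantNorm ℤ).factorization r ∧
          i ∣ S.xi (fun n => W.LFunction n) ∧
          P.modularDegree * i = S.xi (fun n => W.LFunction n) * j

/-- **L5 (XS, PROVED)**: `ord_r (M r) = 1` for `r` prime, `gcd(M, r) = 1`, `M ≠ 0`. -/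
theorem factorization_mul_eq_one {M r : ℕ} (hM : M ≠ 0) (hr : r.Prime) (hcop : M.Coprime r) :
    (M * r).factorization r = 1 := by
  have hnd : ¬ r ∣ M := (Nat.Prime.coprime_iff_not_dvd hr).mp hcop.symm
  rw [Nat.factorization_mul hM hr.ne_zero, Finsupp.add_apply, hr.factorization_self,
    Nat.factorization_eq_zero_of_not_dvd hnd]

/-- **L6 (S, PROVED)**: the stub AS TYPED from T_opt and Carayol. -/
theorem stub_of_optimal
    (hCar : ∀ {N : ℕ} [NeZero N], IsNewformOf.level_eq_conductorNorm (N := N))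
    (hT : takahashi2001_thm_2_3_optimal) : takahashi2001_thm_2_3_of_coprime := by
  intro W _ M r _ hr hcop hN P hmin S
  have hM : M ≠ 0 := fun h0 => NeZero.ne (M * r) (by rw [h0, zero_mul])
  have h1 : (W.conductorNorm ℤ).factorization r = 1 := by
    rw [hN]; exact factorization_mul_eq_one hM hr hcop
  exact hT W M r hr hcop h1 P (latticeOptimal_of_conductorMinimal hCar P hmin) S

/-- **L6′ (PROVED)**: the same with modularity at the conductor level (`exists_isNewformOf`,
BCDT Thm. A) in place of Carayol (tree: `IsNewformOf.level_eq_conductorNorm_of_exists_isNewformOf'`). -/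
theorem stub_of_optimal' (hmod : exists_isNewformOf) (hT : takahashi2001_thm_2_3_optimal) :
    takahashi2001_thm_2_3_of_coprime :=
  stub_of_optimal (fun {_} _ => IsNewformOf.level_eq_conductorNorm_of_exists_isNewformOf' hmod) hT

/-! ### The re-cut: consuming T_opt at the skeleton's own `(W₀, D₀, h₀)` -/

/-- **New bookkeeping stub of the re-cut (S, PROVED)**: a curve `ℚ`-isogenous to a Frey curve has
`f_q = 1` at every odd prime `q` of the Frey conductor — Frey curves are multiplicative at odd bad
primes (`hasMultiplicativeReductionAt_freyCurve_of_ne_two`, `dvd_of_dvd_conductorNorm_freyCurve`),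
multiplicative reduction is isogeny-invariant (`hasMultiplicativeReductionAt_of_isIsogenous`,
THEOREM), and `f_v = 1 ↔` multiplicative (`conductorExponent_eq_one_iff_holds`,
`factorization_conductorNorm_holds`).  Replaces `exists_conductorMinimal` + Carayol. -/
theorem factorization_conductorNorm_eq_one_of_isIsogenous_freyCurve (a b : ℤ) (hab : IsCoprime a b)
    (h0 : a * b * (a + b) ≠ 0) {q : ℕ} (hq : q.Prime) (hq2 : q ≠ 2)
    (hqN : q ∣ (freyCurve a b).conductorNorm ℤ) (W₀ : WeierstrassCurve ℚ) [W₀.IsElliptic]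
    (hiso : (freyCurve a b).IsIsogenous W₀) : (W₀.conductorNorm ℤ).factorization q = 1 := by
  haveI := isElliptic_freyCurve h0
  set v : HeightOneSpectrum ℤ := (Rat.HeightOneSpectrum.primesEquiv (R := ℤ)).symm ⟨q, hq⟩
    with hv
  have hgen : Rat.HeightOneSpectrum.natGenerator v = q :=
    Rat.natGenerator_primesEquiv_symm ⟨q, hq⟩
  have hmulE : (freyCurve a b).HasMultiplicativeReductionAt v :=
    Literature.NumberTheory.DiophantineGeometry.hasMultiplicativeReductionAt_freyCurve_of_ne_two
      hab h0 v (by rw [hgen]; exact hq2)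
      (by rw [hgen]
          exact Literature.NumberTheory.DiophantineGeometry.dvd_of_dvd_conductorNorm_freyCurve
            hab h0 hq hq2 hqN)
  have hmul : W₀.HasMultiplicativeReductionAt v :=
    hasMultiplicativeReductionAt_of_isIsogenous hiso v hmulE
  have h1 : W₀.conductorExponent v = 1 := (conductorExponent_eq_one_iff_holds v W₀).mpr hmul
  rw [← hgen, factorization_conductorNorm_holds W₀ v]
  exact h1

/-- Corollary of T_opt in the shape the composition consumes (as the tree's
`takahashi2001_thm_2_3_of_coprime.modularDegree_le_brandtXi_mul`; PROVED). -/
theorem modularDegree_le_brandtXi_mul_of_optimal (hT : takahashi2001_thm_2_3_optimal)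
    (W : WeierstrassCurve ℚ) [W.IsElliptic] (M r : ℕ) [NeZero (M * r)] (hr : r.Prime)
    (hcop : M.Coprime r) (h1 : (W.conductorNorm ℤ).factorization r = 1)
    (P : ModularParametrizationData W (M * r))
    (hopt : ∀ z ∈ P.L.lattice, ∃ w ∈ periodLattice P.f, z = P.c * w) :
    P.modularDegree ≤
      brandtXi M r (fun n => W.LFunction n) * (W.minimalDiscriminantNorm ℤ).factorization r := by
  obtain ⟨S, hS⟩ := exists_brandtXi_eq (takahashi2001_thm_2_3_of_coprime.nonempty_xiSetup' hr hcop)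
    (fun n => W.LFunction n)
  rw [hS]
  obtain ⟨i, j, hi, hij, -, hδ⟩ := hT W M r hr hcop h1 P hopt S
  calc P.modularDegree ≤ P.modularDegree * i := Nat.le_mul_of_pos_right _ hi
    _ = S.xi (fun n => W.LFunction n) * j := hδ
    _ ≤ S.xi (fun n => W.LFunction n) * (i * j) :=
        Nat.mul_le_mul_left _ (Nat.le_mul_of_pos_left _ hi)
    _ = _ := by rw [hij]

/-- Verbatim the statement of `Sketch.isIsogenous_of_f_eq` — PROVED in the registered skeleton
(`Lines/Sketch.lean`, from `exists_optimalDatum'` and `isIsogenous_of_forall_mul_mem_lattice`);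
restated here only because the skeleton module is not built on the farm. -/
theorem isIsogenous_of_f_eq {W W' : WeierstrassCurve ℚ} [W.IsElliptic] [W'.IsElliptic] {N : ℕ}
    [NeZero N] (D : ModularParametrizationData W N) (D' : ModularParametrizationData W' N)
    (hf : D'.f = D.f) : W.IsIsogenous W' := by
  sorry

/-- **The re-cut composition (kernel-checked; constant `4·163²` unchanged)**: the crux from
T_opt and the two Pasten facts, with Takahashi applied at the lattice-optimal `(W₀, D₀)`
DIRECTLY (`f_q(W₀) = 1` by `factorization_conductorNorm_eq_one_of_isIsogenous_freyCurve`);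
the conductor-restricted pivot `(W⋆, P⋆)` (`exists_conductorMinimal`), the step `h0s` and every
appeal to Carayol are gone.  Chain: `deg D ≤ 4 deg D₁ ≤ 4·163 deg D₀ ≤ 4·163 ξ v_q(Δ_min W₀)
≤ 4·163² ξ v_q(Δ_min E)`. -/
theorem DefiniteRTControlPrime_of_optimal (hT : takahashi2001_thm_2_3_optimal)
    (h163 : PastenShimura2024_minimalDegree_le_163_mul) (h68 : PastenShimura2024_lemma_6_8) :
    DefiniteRTControlPrime := by
  intro ε hε
  refine ⟨4 * 163 * 163, ?_⟩
  intro a b hab h0 N _ hN q hq hq2 hqN D hDmin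
  -- `N = M q`
  obtain ⟨M, hM⟩ := hqN
  rw [mul_comm] at hM
  subst hM
  haveI := isElliptic_freyCurve h0
  have hdiv : M * q / q = M := Nat.mul_div_cancel M hq.pos
  rw [hdiv]
  have hqN' : q ∣ (freyCurve a b).conductorNorm ℤ := by rw [hN]; exact Dvd.intro_left M rfl
  -- `gcd(M, q) = 1`
  have hcop : M.Coprime q := by
    have h := Summit.ABC.ABC.Theorems.DefiniteRTControlPrime.stub_freyLocal a b hab h0 q hq hq2 hqN'
    rwa [hN, hdiv] at h
  -- a global minimal model `W_m = C • E`, its data, a minimal one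
  obtain ⟨C, hC⟩ := hasGlobalMinimalModel_rat_holds (freyCurve a b)
  haveI := hC
  have hne : Nonempty (ModularParametrizationData (C • freyCurve a b) (M * q)) :=
    (Summit.ABC.ABC.Theorems.nonempty_modularParametrizationData_smul_iff C).mpr ⟨D⟩
  obtain ⟨D₁, -, hD₁min⟩ := exists_minimal_datum hne
  -- the lattice-optimal datum of the class of `f₁ := D₁.f`
  obtain ⟨W₀, hW₀, D₀, hf₀, h₀⟩ := D₁.exists_optimalDatum'
  haveI := hW₀
  have hker₀ : D₀.isogenyMap.ker = ⊥ := D₀.isogenyMap_ker_eq_bot_iff.mpr h₀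
  have hmin₀ : ∀ (W' : WeierstrassCurve ℚ) [W'.IsElliptic]
      (D' : ModularParametrizationData W' (M * q)), D'.f = D₀.f →
        D₀.modularDegree ≤ D'.modularDegree := fun W' _ D' hD' =>
    D₀.modularDegree_le_of_isogenyMap_ker_eq_bot hker₀ D' hD'
  -- (T_deg) `deg D₁ ≤ 163 · deg D₀`
  have h163' : D₁.modularDegree ≤ 163 * D₀.modularDegree :=
    h163 (M * q) W₀ (C • freyCurve a b) D₀ D₁ hf₀.symm hmin₀ hD₁min
  -- `E ~ W_m ~ W₀`, so `W₀` is multiplicative at `q`: `f_q(W₀) = 1` (NEW, replaces the pivot)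
  have hiso : (freyCurve a b).IsIsogenous W₀ :=
    (isIsogenous_smul (freyCurve a b) C).trans' (isIsogenous_of_f_eq D₁ D₀ hf₀)
  have hf1 : (W₀.conductorNorm ℤ).factorization q = 1 :=
    factorization_conductorNorm_eq_one_of_isIsogenous_freyCurve a b hab h0 hq hq2 hqN' W₀ hiso
  -- Takahashi (local-optimal form) at `(W₀, D₀, h₀)` directly
  have hTak : D₀.modularDegree ≤ brandtXi M q (fun n => W₀.LFunction n) *
      (W₀.minimalDiscriminantNorm ℤ).factorization q :=
    modularDegree_le_brandtXi_mul_of_optimal hT W₀ M q hq hcop hf1 D₀ h₀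
  -- `a(W₀) = a(f₁) = a(W_m) = a(E)`
  have hL : (fun n => W₀.LFunction n) = fun n => (freyCurve a b).LFunction n := by
    funext n
    have h1 := D₀.isNewformOf.2 n
    have h2 := D₁.isNewformOf.2 n
    rw [hf₀] at h1
    rw [h1, LFunction_smul] at h2
    exact_mod_cast h2
  rw [hL] at hTak
  -- (T_val) along `E ~ W₀`
  have hval : (W₀.minimalDiscriminantNorm ℤ).factorization q ≤
      163 * ((freyCurve a b).minimalDiscriminantNorm ℤ).factorization q :=
    Summit.ABC.ABC.Theorems.DefiniteRTControlPrime.stub_valTransport h68 a b hab h0 q hq hq2 hqN'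
      W₀ hiso
  -- (T_model) back to the Frey model
  obtain ⟨D₁', -, hdeg₁'⟩ :=
    Summit.ABC.ABC.Theorems.DefiniteRTControlPrime.stub_smulTransportDeg C D₁
  have hscale : (C.u : ℚ).num.natAbs ≤ 2 :=
    Summit.ABC.ABC.Theorems.DefiniteRTControlPrime.stub_freyScale a b hab h0 C hC
  have hD : D.deg ≤ 4 * D₁.modularDegree := by
    calc D.deg ≤ D₁'.deg := hDmin D₁'
      _ = (C.u : ℚ).num.natAbs ^ 2 * D₁.deg := hdeg₁'
      _ ≤ 2 ^ 2 * D₁.deg := Nat.mul_le_mul_right _ (Nat.pow_le_pow_left hscale 2)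
      _ = 4 * D₁.modularDegree := by norm_num [ModularParametrizationData.modularDegree]
  -- the chain in `ℕ` (one step shorter than the skeleton's)
  set ξ : ℕ := brandtXi M q (fun n => (freyCurve a b).LFunction n) with hξ
  set v : ℕ := ((freyCurve a b).minimalDiscriminantNorm ℤ).factorization q with hv
  have hchain : D.deg ≤ 4 * 163 * 163 * (ξ * v) :=
    calc D.deg ≤ 4 * D₁.modularDegree := hD
      _ ≤ 4 * (163 * D₀.modularDegree) := Nat.mul_le_mul_left _ h163'
      _ ≤ 4 * (163 * (ξ * (W₀.minimalDiscriminantNorm ℤ).factorization q)) :=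
          Nat.mul_le_mul_left _ (Nat.mul_le_mul_left _ hTak)
      _ ≤ 4 * (163 * (ξ * (163 * v))) :=
          Nat.mul_le_mul_left _ (Nat.mul_le_mul_left _ (Nat.mul_le_mul_left _ hval))
      _ = 4 * 163 * 163 * (ξ * v) := by ring
  -- to `ℝ`, inserting the idle `N^ε ≥ 1`
  have hN1 : (1 : ℝ) ≤ ((M * q : ℕ) : ℝ) := by
    exact_mod_cast Nat.one_le_iff_ne_zero.mpr (NeZero.ne (M * q))
  have hrpow : (1 : ℝ) ≤ ((M * q : ℕ) : ℝ) ^ ε := Real.one_le_rpow hN1 hε.le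
  have hcast : (D.deg : ℝ) ≤ (4 * 163 * 163 : ℝ) * ((ξ : ℝ) * (v : ℝ)) := by
    exact_mod_cast hchain
  have hξv : (0 : ℝ) ≤ (ξ : ℝ) * (v : ℝ) := by positivity
  calc (D.deg : ℝ) ≤ (4 * 163 * 163 : ℝ) * ((ξ : ℝ) * (v : ℝ)) := hcast
    _ = (4 * 163 * 163 : ℝ) * 1 * ((ξ : ℝ) * (v : ℝ)) := by ring
    _ ≤ (4 * 163 * 163 : ℝ) * ((M * q : ℕ) : ℝ) ^ ε * ((ξ : ℝ) * (v : ℝ)) := by gcongr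

/-! ## T3. The Frey-level regime (scope note for the quaternionic half) -/

/-- Levels met by the skeleton: `ord₂ N ≤ 8` and `N` square-free away from `2`. -/
def IsFreyLevel (N : ℕ) : Prop :=
  N.factorization 2 ≤ 8 ∧ ∀ p : ℕ, p.Prime → p ≠ 2 → N.factorization p ≤ 1

/-- **L7 (S)**: the conductor of a Frey curve is square-free away from `2`
(`conductorNorm_freyCurve_dvd_holds`: `N ∣ 2⁸ · rad(ab(a+b))`; pattern of the closed
`stub_freyLocal`). -/
theorem factorization_conductorNorm_freyCurve_le_one (a b : ℤ) (hab : IsCoprime a b)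
    (h0 : a * b * (a + b) ≠ 0) {p : ℕ} (_hp : p.Prime) (hp2 : p ≠ 2) :
    ((freyCurve a b).conductorNorm ℤ).factorization p ≤ 1 := by
  have hdvd := conductorNorm_freyCurve_dvd_holds a b hab h0
  set R := (UniqueFactorizationMonoid.radical (a * b * (a + b))).natAbs with hR_def
  have hR : Squarefree R := Int.squarefree_natAbs.mpr UniqueFactorizationMonoid.squarefree_radical
  have hR0 : R ≠ 0 := hR.ne_zero
  rcases eq_or_ne ((freyCurve a b).conductorNorm ℤ) 0 with hN0 | hN0
  · simp [hN0]
  · have h1 : ((freyCurve a b).conductorNorm ℤ).factorization p ≤ (2 ^ 8 * R).factorization p :=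
      (Nat.factorization_le_iff_dvd hN0 (mul_ne_zero (by norm_num) hR0)).mpr hdvd p
    have h2 : (2 ^ 8 * R).factorization p = R.factorization p := by
      rw [Nat.factorization_mul (by norm_num) hR0, Finsupp.add_apply, Nat.factorization_pow,
        Finsupp.smul_apply, Nat.prime_two.factorization, Finsupp.single_apply,
        if_neg (fun h => hp2 h.symm), smul_zero, zero_add]
    exact h1.trans (h2 ▸ hR.natFactorization_le_one p)

/-- **L7′ (S)**: … and `ord₂ N ≤ 8`; so every cofactor `M = N / q` of the skeleton is a Frey level. -/
theorem isFreyLevel_conductorNorm_freyCurve (a b : ℤ) (hab : IsCoprime a b)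
    (h0 : a * b * (a + b) ≠ 0) : IsFreyLevel ((freyCurve a b).conductorNorm ℤ) := by
  sorry

/-- **H0_Frey (named-fact input restricted to the regime)**: the Eichler–Selberg identity
(`HeckeTraceFormulaGL2Level N 1 2`, Schoof–van der Vlugt Thm. 2.2) is consumed by the rank-one
reduction (k1 `stub_takahashi_of_plan`, k3 H0→H1) only at the two levels `M` and `M r`, both Frey
levels; at square-free level it is the tree's THEOREM `cuspidalHeckeTrace_eq_geometricSide`, so
the residual quaternionic debt of the skeleton is E–S at levels `2^e m`, `2 ≤ e ≤ 8`, `m` odd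
square-free (Hijikata's local data at `2`). -/
def heckeTraceFormula_freyLevels : Prop :=
  ∀ (N : ℕ) [NeZero N], IsFreyLevel N → HeckeTraceFormulaGL2Level N 1 2

end Summit.ABC.ABC.Cruxes.DefiniteRTControlPrime.StubIdeas2G2

end
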